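import Summits.NavierStokesRegularity.FluidComputer.HomSobolevLadder
import HarnessLib

/-!
# Fluid computer — the SOBOLEV LADDER read at SHARP WAVENUMBERS (L52″–L52⁗): spectral moments, the spectral front
# clock, the countdown per wavenumber and the divergence of every spectral tail

HONEST FRAMING (cell `pub-fluidc`, verbatim): *low prior, high value-of-information experiment on Tao's
machine paradigm; NOT a claim that NS blows up.* Theorem side of the cell; nothing here is evidence of blow-up.

Every 'front' statement of the dictionary so far (L20′/L20″, L22′/L22″, L51″/L51‴) is phrased in Littlewood–Paley
BLOCKS `Δ̇_j`, and the cell's readers measure SHARP spectral bands — the two are not the same objects (RULING R33,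
`BandSupOvershoot`). The `Ḣ^s` currency of L52 (`HomSobolevLadder.homSobolev_clock`) lives on the Fourier side with no
blocks at all: `‖u(t)‖_{Ḣ^s}² = ∫ ‖ξ‖^{2s} ‖û(t)(ξ)‖² dξ` is the `s`-th SPECTRAL MOMENT, and it splits at a SHARP
wavenumber `K` into the head `∫_{‖ξ‖<K}` and the tail `∫_{‖ξ‖≥K}`. For every `s ∈ (1/2, 3/2)`, along every maximal
smooth Leray–Hopf solution of the unforced Navier–Stokes system on `ℝ³` (`ν > 0`):

* `lintegral_weight_le_head_add_tail` — for any `L²` class `f`, any `K` and `s ≥ 0`: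
  `∫ ‖ξ‖^{2s}‖𝓕f‖² ≤ K^{2s} ‖f‖₂² + ∫_{‖ξ‖≥K} ‖ξ‖^{2s}‖𝓕f‖²` (Plancherel on the head);
* `spectral_clock` (**L52″**) — `c_s ν^{(5−2s)/2} (T − t)^{−(2s−1)/2} ≤ ∫ ‖ξ‖^{2s} ‖û(t)(ξ)‖² dξ` at every `t ∈ (0, T)`
  (L52 squared);
* `spectral_front_clock` — for EVERY `K ≥ 0`: `c_s ν^{(5−2s)/2} (T − t)^{−(2s−1)/2} ≤ K^{2s} ‖u(0)‖₂² +
  ∫_{‖ξ‖≥K} ‖ξ‖^{2s} ‖û(t)(ξ)‖² dξ` (Leray's energy inequality on the head);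
* `spectral_countdown` (**L52‴ — THE COUNTDOWN PER WAVENUMBER**) — IF the `s`-spectral tail above `K` holds no more
  than the head allowance `K^{2s}‖u(0)‖₂²` ('the `s`-spectrum has not passed `K`') THEN
  `c_s ν^{(5−2s)/2} ≤ 2 K^{2s} ‖u(0)‖₂² (T − t)^{(2s−1)/2}`: each unpassed WAVENUMBER certifies time
  `T − t ≳ (ν^{(5−2s)/2} ‖u(0)‖₂^{−2} K^{−2s})^{2/(2s−1)}`, i.e. the spectral `s`-front must climb at least like
  `K(t) ≳ (ν^{(5−2s)/4} ‖u(0)‖₂^{−1} (T − t)^{−(2s−1)/4})^{1/s}`;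
* `spectral_tail_eventually_gt` (**L52⁗ — ABOVE EVERY FIXED WAVENUMBER**) — for every `K` and every `M` the tail
  `∫_{‖ξ‖≥K} ‖ξ‖^{2s}‖û(t)‖²` exceeds `M` for all `t` in a whole left neighbourhood of `T`.

Technical form: the Fourier transform is Mathlib's `𝓕` on `L²` classes; the slice enters through its complexification
`EuclideanSpace.complexify ∘ u t ∈ L²` and ANY `L²`-membership witness `h2` (all statements are quantified over `h2`,
whose choice does not change the class). No new definitions.

Reading for the atlas. With `E(k, t)` the shell spectrum of a periodic run the analogous rows are `Σ_{k≥K} k^{2s}E(k,t)`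
for sharp `K`: the necessity says each of them diverges as `t ↑ T`, and while the tail above `K` is below `K^{2s}E₀`
the blow-up is at least `∝ (ν^{(5−2s)/2}/(E₀ K^{2s}))^{2/(2s−1)}` away. HONEST SIZE NOTE: `c_s` inexplicit (square of
L52's), degenerate at both ends of `(1/2, 3/2)`; class = `ℝ³` finite energy (the periodic reading is an analogy; the
tree's torus version of the rate is `Literature…Torus.hsSeminorm_blowup_rate`). Words and shapes, never numbers at the
cell's levels. Necessity only; nothing about sufficiency. 0 sorry; no new definitions, no named facts.

## References

* J. C. Robinson, W. Sadowski, Rend. Semin. Mat. Univ. Padova 131 (2014) 159–178, Corollaries 9–10.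
  [RobinsonSadowski2014]
* J. Leray, Acta Math. 63 (1934), §22 p. 227. [Leray1934]
* H. Bahouri, J.-Y. Chemin, R. Danchin, *Fourier Analysis and Nonlinear PDE*, Springer 2011, Def. 1.31,
  Thm. 1.38. [BahouriCheminDanchin2011]
-/

noncomputable section

open MeasureTheory SchwartzMap FourierTransform Complex Set Function Filter Topology Metric
open scoped ENNReal NNReal
open Literature.Analysis.FluidPDE Literature.Analysis.FunctionSpaces
open Summit.NavierStokesRegularity.FluidComputer.SobolevLadderFront
open Summit.NavierStokesRegularity.FluidComputer.HomSobolevLadder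

namespace Summit.NavierStokesRegularity.FluidComputer.SpectralFront

/-! ## Head–tail split of a weighted Fourier integral at a sharp wavenumber -/

/-- **Head–tail split at a sharp wavenumber `K`** (Plancherel on the head): for an `L²` class `f` on `ℝ³`, `s ≥ 0`,
any `K` (of interest for `K ≥ 0`): `∫ ‖ξ‖^{2s} ‖𝓕f(ξ)‖² dξ ≤ K^{2s} ∫ ‖f‖² + ∫_{‖ξ‖ ≥ K} ‖ξ‖^{2s} ‖𝓕f(ξ)‖² dξ`.
[cite: BahouriCheminDanchin2011, Def. 1.31] -/
theorem lintegral_weight_le_head_add_tail (f₂ : Lp (EuclideanSpace ℂ (Fin 3)) 2 (volume : Measure (EuclideanSpace ℝ (Fin 3)))) {s : ℝ} (K : ℝ) (hs : 0 ≤ s) :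
    ∫⁻ ξ, ‖ξ‖ₑ ^ (2 * s) * ‖((𝓕 f₂ : Lp (EuclideanSpace ℂ (Fin 3)) 2 (volume : Measure (EuclideanSpace ℝ (Fin 3)))) : (EuclideanSpace ℝ (Fin 3)) → (EuclideanSpace ℂ (Fin 3))) ξ‖ₑ ^ 2 ≤
      ENNReal.ofReal (K ^ (2 * s)) * (∫⁻ x, ‖(f₂ : (EuclideanSpace ℝ (Fin 3)) → (EuclideanSpace ℂ (Fin 3))) x‖ₑ ^ 2) +
        ∫⁻ ξ in (Metric.ball (0 : (EuclideanSpace ℝ (Fin 3))) K)ᶜ,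
          ‖ξ‖ₑ ^ (2 * s) * ‖((𝓕 f₂ : Lp (EuclideanSpace ℂ (Fin 3)) 2 (volume : Measure (EuclideanSpace ℝ (Fin 3)))) : (EuclideanSpace ℝ (Fin 3)) → (EuclideanSpace ℂ (Fin 3))) ξ‖ₑ ^ 2 := by
  set G : (EuclideanSpace ℝ (Fin 3)) → (EuclideanSpace ℂ (Fin 3)) := ((𝓕 f₂ : Lp (EuclideanSpace ℂ (Fin 3)) 2 (volume : Measure (EuclideanSpace ℝ (Fin 3)))) : (EuclideanSpace ℝ (Fin 3)) → (EuclideanSpace ℂ (Fin 3))) with hG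
  set w : (EuclideanSpace ℝ (Fin 3)) → ℝ≥0∞ := fun ξ => ‖ξ‖ₑ ^ (2 * s) * ‖G ξ‖ₑ ^ 2 with hw
  have hwt : ∀ ξ ∈ Metric.ball (0 : (EuclideanSpace ℝ (Fin 3))) K, w ξ ≤ ENNReal.ofReal (K ^ (2 * s)) * ‖G ξ‖ₑ ^ 2 := by
    intro ξ hξ
    refine mul_le_mul' ?_ le_rfl
    rw [← ofReal_norm, ENNReal.ofReal_rpow_of_nonneg (norm_nonneg _) (by positivity)]
    exact ENNReal.ofReal_le_ofReal
      (Real.rpow_le_rpow (norm_nonneg _) (le_of_lt (mem_ball_zero_iff.1 hξ)) (by positivity))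
  have hhead : ∫⁻ ξ in Metric.ball (0 : (EuclideanSpace ℝ (Fin 3))) K, w ξ ≤
      ENNReal.ofReal (K ^ (2 * s)) * ∫⁻ x, ‖(f₂ : (EuclideanSpace ℝ (Fin 3)) → (EuclideanSpace ℂ (Fin 3))) x‖ₑ ^ 2 :=
    calc ∫⁻ ξ in Metric.ball (0 : (EuclideanSpace ℝ (Fin 3))) K, w ξ
        ≤ ∫⁻ ξ in Metric.ball (0 : (EuclideanSpace ℝ (Fin 3))) K, ENNReal.ofReal (K ^ (2 * s)) * ‖G ξ‖ₑ ^ 2 :=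
          setLIntegral_mono' measurableSet_ball hwt
      _ = ENNReal.ofReal (K ^ (2 * s)) * ∫⁻ ξ in Metric.ball (0 : (EuclideanSpace ℝ (Fin 3))) K, ‖G ξ‖ₑ ^ 2 :=
          lintegral_const_mul' _ _ ENNReal.ofReal_ne_top
      _ ≤ ENNReal.ofReal (K ^ (2 * s)) * ∫⁻ ξ, ‖G ξ‖ₑ ^ 2 :=
          mul_le_mul' le_rfl (setLIntegral_le_lintegral _ _)
      _ = ENNReal.ofReal (K ^ (2 * s)) * ∫⁻ x, ‖(f₂ : (EuclideanSpace ℝ (Fin 3)) → (EuclideanSpace ℂ (Fin 3))) x‖ₑ ^ 2 := by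
          rw [hG, SobolevEmbeddingHalf.lintegral_enorm_sq_fourier_Lp_eq]
  calc ∫⁻ ξ, w ξ = (∫⁻ ξ in Metric.ball (0 : (EuclideanSpace ℝ (Fin 3))) K, w ξ) + ∫⁻ ξ in (Metric.ball (0 : (EuclideanSpace ℝ (Fin 3))) K)ᶜ, w ξ :=
        (lintegral_add_compl w measurableSet_ball).symm
    _ ≤ ENNReal.ofReal (K ^ (2 * s)) * (∫⁻ x, ‖(f₂ : (EuclideanSpace ℝ (Fin 3)) → (EuclideanSpace ℂ (Fin 3))) x‖ₑ ^ 2) +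
          ∫⁻ ξ in (Metric.ball (0 : (EuclideanSpace ℝ (Fin 3))) K)ᶜ, w ξ := add_le_add hhead (le_refl _)

/-- **The squared `Ḣ^s` seminorm of an `L²` field is its `s`-th spectral moment**: for `f ∈ L²(ℝ³; ℂ³)` and any
`L²`-membership witness `h2`, `‖f‖_{Ḣ^s}² = ∫ ‖ξ‖^{2s} ‖𝓕f(ξ)‖² dξ` (unfolding `Function.eHomSobolevSeminorm`).
[cite: BahouriCheminDanchin2011, Def. 1.31] -/
theorem eHomSobolevSeminorm_sq_eq {f : (EuclideanSpace ℝ (Fin 3)) → (EuclideanSpace ℂ (Fin 3))} (h2 : MemLp f 2 volume) (s : ℝ) :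
    Function.eHomSobolevSeminorm s f ^ 2 =
      ∫⁻ ξ, ‖ξ‖ₑ ^ (2 * s) * ‖((𝓕 (h2.toLp f) : Lp (EuclideanSpace ℂ (Fin 3)) 2 (volume : Measure (EuclideanSpace ℝ (Fin 3)))) : (EuclideanSpace ℝ (Fin 3)) → (EuclideanSpace ℂ (Fin 3))) ξ‖ₑ ^ 2 := by
  rw [Function.eHomSobolevSeminorm, dif_pos h2, Literature.Analysis.FunctionSpaces.eHomSobolevSeminorm,
    ← ENNReal.rpow_natCast, ← ENNReal.rpow_mul]
  norm_num

/-- **The energy of the complexified slice**: for `v ∈ L²(ℝ³; ℝ³)` and any witness `h2` of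
`complexify ∘ v ∈ L²`, `∫ ‖(toLp (complexify ∘ v))‖² = ‖v‖₂²`. [folklore] -/
theorem lintegral_toLp_complexify_sq {v : (EuclideanSpace ℝ (Fin 3)) → (EuclideanSpace ℝ (Fin 3))} (h2 : MemLp (⇑EuclideanSpace.complexify ∘ v) 2 volume) :
    ∫⁻ x, ‖((h2.toLp _ : Lp (EuclideanSpace ℂ (Fin 3)) 2 (volume : Measure (EuclideanSpace ℝ (Fin 3)))) : (EuclideanSpace ℝ (Fin 3)) → (EuclideanSpace ℂ (Fin 3))) x‖ₑ ^ 2 = eLpNorm v 2 volume ^ 2 := by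
  have h1 : ∫⁻ x, ‖((h2.toLp _ : Lp (EuclideanSpace ℂ (Fin 3)) 2 (volume : Measure (EuclideanSpace ℝ (Fin 3)))) : (EuclideanSpace ℝ (Fin 3)) → (EuclideanSpace ℂ (Fin 3))) x‖ₑ ^ 2 =
      ∫⁻ x, ‖(⇑EuclideanSpace.complexify ∘ v) x‖ₑ ^ 2 :=
    lintegral_congr_ae (h2.coeFn_toLp.mono fun x hx => by simp only [hx])
  have hn : eLpNorm (⇑EuclideanSpace.complexify ∘ v) 2 volume = eLpNorm v 2 volume :=
    eLpNorm_congr_norm_ae (Eventually.of_forall fun x => EuclideanSpace.norm_complexify (v x))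
  have h3 := eLpNorm_natCast_pow_eq_lintegral volume (⇑EuclideanSpace.complexify ∘ v) (n := 2) (by norm_num)
  simp only [Nat.cast_ofNat] at h3
  rw [h1, ← h3, hn]

/-! ## L52″: the spectral moments on Leray's clock -/

/-- **L52″ — THE `s`-TH SPECTRAL MOMENT ON LERAY'S CLOCK.** For every `s ∈ (1/2, 3/2)` there is `c = c_s > 0` such that
along every maximal smooth solution `(u, p)` of the unforced Navier–Stokes system on `ℝ³ × [0, T)` (`ν > 0`) which is
Leray–Hopf from `u 0`, at EVERY `t ∈ (0, T)` and for every `L²` witness `h2` of the complexified slice: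
`c · ν^{(5−2s)/2} · (T − t)^{−(2s−1)/2} ≤ ∫ ‖ξ‖^{2s} ‖û(t)(ξ)‖² dξ` (L52 squared).
[cite: RobinsonSadowski2014, Corollary 10] [cite: Leray1934, §22 p. 227] -/
theorem spectral_clock (s : ℝ) (hs : s ∈ Ioo (1 / 2 : ℝ) (3 / 2)) :
    ∃ c : ℝ, 0 < c ∧ ∀ (ν T : ℝ), 0 < ν → 0 < T →
      ∀ (u : ℝ → (EuclideanSpace ℝ (Fin 3)) → (EuclideanSpace ℝ (Fin 3))) (p : ℝ → (EuclideanSpace ℝ (Fin 3)) → ℝ),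
      IsMaximalSmoothSolution ν 0 u p T → IsLerayHopfOn T ν 0 (u 0) u →
      ∀ t ∈ Ioo 0 T, ∀ h2 : MemLp (⇑EuclideanSpace.complexify ∘ u t) 2 volume,
        ENNReal.ofReal (c * ν ^ ((5 - 2 * s) / 2) * (T - t) ^ (-((2 * s - 1) / 2))) ≤
          ∫⁻ ξ, ‖ξ‖ₑ ^ (2 * s) *
            ‖((𝓕 (h2.toLp _) : Lp (EuclideanSpace ℂ (Fin 3)) 2 (volume : Measure (EuclideanSpace ℝ (Fin 3)))) : (EuclideanSpace ℝ (Fin 3)) → (EuclideanSpace ℂ (Fin 3))) ξ‖ₑ ^ 2 := by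
  obtain ⟨c, hc, H⟩ := homSobolev_clock s hs
  refine ⟨c ^ 2, by positivity, fun ν T hν hT u p hmax hLH t ht h2 => ?_⟩
  have hTt : 0 < T - t := sub_pos.2 ht.2
  have h := H ν T hν hT u p hmax hLH t ht
  have h' := pow_le_pow_left' h 2
  rw [eHomSobolevSeminorm_sq_eq h2 s] at h'
  refine le_trans (le_of_eq ?_) h'
  rw [← ENNReal.ofReal_pow (by positivity)]
  congr 1
  rw [mul_pow, mul_pow, ← Real.rpow_natCast (ν ^ _), ← Real.rpow_natCast ((T - t) ^ _),
    ← Real.rpow_mul hν.le, ← Real.rpow_mul hTt.le]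
  congr 2 <;> push_cast <;> ring

/-- **L52″ — THE SPECTRAL `s`-FRONT CLOCK AT A SHARP WAVENUMBER.** With `c = c_s` of `spectral_clock`: along every
maximal smooth Leray–Hopf solution of the unforced system (`ν > 0`), at EVERY `t ∈ (0, T)`, for every `L²` witness
`h2` of the complexified slice and EVERY wavenumber `K ≥ 0`:
`c ν^{(5−2s)/2} (T − t)^{−(2s−1)/2} ≤ K^{2s} ‖u(0)‖₂² + ∫_{‖ξ‖≥K} ‖ξ‖^{2s} ‖û(t)(ξ)‖² dξ` — the spectrum below `K` carries
at most `K^{2s}` times the energy, which does not increase (Leray). [cite: RobinsonSadowski2014, Corollary 10]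
[cite: Leray1934, §22 p. 227] -/
theorem spectral_front_clock (s : ℝ) (hs : s ∈ Ioo (1 / 2 : ℝ) (3 / 2)) :
    ∃ c : ℝ, 0 < c ∧ ∀ (ν T : ℝ), 0 < ν → 0 < T →
      ∀ (u : ℝ → (EuclideanSpace ℝ (Fin 3)) → (EuclideanSpace ℝ (Fin 3))) (p : ℝ → (EuclideanSpace ℝ (Fin 3)) → ℝ),
      IsMaximalSmoothSolution ν 0 u p T → IsLerayHopfOn T ν 0 (u 0) u →
      ∀ t ∈ Ioo 0 T, ∀ h2 : MemLp (⇑EuclideanSpace.complexify ∘ u t) 2 volume, ∀ K : ℝ,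
        ENNReal.ofReal (c * ν ^ ((5 - 2 * s) / 2) * (T - t) ^ (-((2 * s - 1) / 2))) ≤
          ENNReal.ofReal (K ^ (2 * s)) * eLpNorm (u 0) 2 volume ^ 2 +
            ∫⁻ ξ in (Metric.ball (0 : (EuclideanSpace ℝ (Fin 3))) K)ᶜ, ‖ξ‖ₑ ^ (2 * s) *
              ‖((𝓕 (h2.toLp _) : Lp (EuclideanSpace ℂ (Fin 3)) 2 (volume : Measure (EuclideanSpace ℝ (Fin 3)))) : (EuclideanSpace ℝ (Fin 3)) → (EuclideanSpace ℂ (Fin 3))) ξ‖ₑ ^ 2 := by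
  obtain ⟨c, hc, H⟩ := spectral_clock s hs
  refine ⟨c, hc, fun ν T hν hT u p hmax hLH t ht h2 K => (H ν T hν hT u p hmax hLH t ht h2).trans ?_⟩
  have hs0 : 0 ≤ s := by linarith [hs.1]
  refine (lintegral_weight_le_head_add_tail (h2.toLp _) K hs0).trans (add_le_add (mul_le_mul' le_rfl ?_) le_rfl)
  calc ∫⁻ x, ‖((h2.toLp _ : Lp (EuclideanSpace ℂ (Fin 3)) 2 (volume : Measure (EuclideanSpace ℝ (Fin 3)))) : (EuclideanSpace ℝ (Fin 3)) → (EuclideanSpace ℂ (Fin 3))) x‖ₑ ^ 2 = eLpNorm (u t) 2 volume ^ 2 :=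
        lintegral_toLp_complexify_sq h2
    _ ≤ eLpNorm (u 0) 2 volume ^ 2 := by
        gcongr
        exact hLH.eLpNorm_le_eLpNorm_datum hν.le (hLH.memLp 0 ⟨le_rfl, hT.le⟩) ⟨ht.1.le, ht.2.le⟩

/-- **L52‴ — THE COUNTDOWN PER WAVENUMBER.** With `c = c_s` of `spectral_clock`: along every maximal smooth Leray–Hopf
solution of the unforced system (`ν > 0`), at every `t ∈ (0, T)`, for every `L²` witness `h2` and every `K ≥ 0`: IF the
`s`-spectral tail above `K` is at most the head allowance — `∫_{‖ξ‖≥K} ‖ξ‖^{2s} ‖û(t)(ξ)‖² dξ ≤ K^{2s} ‖u(0)‖₂²` ('the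
`s`-spectrum has not passed `K`') — THEN `c ν^{(5−2s)/2} ≤ 2 K^{2s} ‖u(0)‖₂² (T − t)^{(2s−1)/2}` (real numbers): the
blow-up is at least `(c ν^{(5−2s)/2} / (2 K^{2s} ‖u(0)‖₂²))^{2/(2s−1)}` away — each unpassed wavenumber certifies time
`∝ K^{−4s/(2s−1)}`. [cite: RobinsonSadowski2014, Corollary 10] [cite: Leray1934, §22 p. 227] -/
theorem spectral_countdown (s : ℝ) (hs : s ∈ Ioo (1 / 2 : ℝ) (3 / 2)) :
    ∃ c : ℝ, 0 < c ∧ ∀ (ν T : ℝ), 0 < ν → 0 < T →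
      ∀ (u : ℝ → (EuclideanSpace ℝ (Fin 3)) → (EuclideanSpace ℝ (Fin 3))) (p : ℝ → (EuclideanSpace ℝ (Fin 3)) → ℝ),
      IsMaximalSmoothSolution ν 0 u p T → IsLerayHopfOn T ν 0 (u 0) u →
      ∀ t ∈ Ioo 0 T, ∀ h2 : MemLp (⇑EuclideanSpace.complexify ∘ u t) 2 volume, ∀ K : ℝ, 0 ≤ K →
        (∫⁻ ξ in (Metric.ball (0 : (EuclideanSpace ℝ (Fin 3))) K)ᶜ, ‖ξ‖ₑ ^ (2 * s) *
            ‖((𝓕 (h2.toLp _) : Lp (EuclideanSpace ℂ (Fin 3)) 2 (volume : Measure (EuclideanSpace ℝ (Fin 3)))) : (EuclideanSpace ℝ (Fin 3)) → (EuclideanSpace ℂ (Fin 3))) ξ‖ₑ ^ 2) ≤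
          ENNReal.ofReal (K ^ (2 * s)) * eLpNorm (u 0) 2 volume ^ 2 →
        c * ν ^ ((5 - 2 * s) / 2) ≤
          2 * (K ^ (2 * s) * (eLpNorm (u 0) 2 volume).toReal ^ 2) * (T - t) ^ ((2 * s - 1) / 2) := by
  obtain ⟨c, hc, H⟩ := spectral_front_clock s hs
  refine ⟨c, hc, fun ν T hν hT u p hmax hLH t ht h2 K hK htail => ?_⟩
  set E : ℝ≥0∞ := eLpNorm (u 0) 2 volume with hE
  have hEtop : E ≠ ⊤ := (hLH.memLp 0 ⟨le_rfl, hT.le⟩).eLpNorm_ne_top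
  have hTt : 0 < T - t := sub_pos.2 ht.2
  set Hd : ℝ≥0∞ := ENNReal.ofReal (K ^ (2 * s)) * E ^ 2 with hHd
  have hHtop : Hd ≠ ⊤ := ENNReal.mul_ne_top ENNReal.ofReal_ne_top (ENNReal.pow_ne_top hEtop)
  have h := H ν T hν hT u p hmax hLH t ht h2 K
  have h2' : ENNReal.ofReal (c * ν ^ ((5 - 2 * s) / 2) * (T - t) ^ (-((2 * s - 1) / 2))) ≤ 2 * Hd :=
    calc ENNReal.ofReal (c * ν ^ ((5 - 2 * s) / 2) * (T - t) ^ (-((2 * s - 1) / 2)))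
        ≤ Hd + ∫⁻ ξ in (Metric.ball (0 : (EuclideanSpace ℝ (Fin 3))) K)ᶜ, ‖ξ‖ₑ ^ (2 * s) *
            ‖((𝓕 (h2.toLp _) : Lp (EuclideanSpace ℂ (Fin 3)) 2 (volume : Measure (EuclideanSpace ℝ (Fin 3)))) : (EuclideanSpace ℝ (Fin 3)) → (EuclideanSpace ℂ (Fin 3))) ξ‖ₑ ^ 2 := h
      _ ≤ Hd + Hd := add_le_add le_rfl htail
      _ = 2 * Hd := by ring
  -- to real numbers
  have h3 := ENNReal.toReal_mono (ENNReal.mul_ne_top (by norm_num) hHtop) h2'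
  rw [ENNReal.toReal_ofReal (by positivity)] at h3
  have hHd' : (2 * Hd).toReal = 2 * (K ^ (2 * s) * E.toReal ^ 2) := by
    rw [hHd, ENNReal.toReal_mul, ENNReal.toReal_mul, ENNReal.toReal_ofReal (Real.rpow_nonneg hK _),
      ENNReal.toReal_pow]
    norm_num
  rw [hHd'] at h3
  have hpow : 0 < (T - t) ^ ((2 * s - 1) / 2) := Real.rpow_pos_of_pos hTt _
  have e : c * ν ^ ((5 - 2 * s) / 2) =
      c * ν ^ ((5 - 2 * s) / 2) * (T - t) ^ (-((2 * s - 1) / 2)) * (T - t) ^ ((2 * s - 1) / 2) := by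
    rw [mul_assoc (c * ν ^ ((5 - 2 * s) / 2)), ← Real.rpow_add hTt, neg_add_cancel, Real.rpow_zero, mul_one]
  rw [e]
  exact mul_le_mul_of_nonneg_right h3 hpow.le

/-! ## L52⁗: above every fixed wavenumber -/

/-- **L52⁗ — IN EVERY `Ḣ^s` CURRENCY THE BLOW-UP LIVES ABOVE EVERY FIXED WAVENUMBER.** Along every maximal smooth
Leray–Hopf solution of the unforced system (`ν > 0`), for EVERY `s ∈ (1/2, 3/2)`, every wavenumber `K ≥ 0` and every
`M`, there is `t₁ < T` such that for ALL `t ∈ (t₁, T)` and every `L²` witness `h2` of the complexified slice: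
`M < ∫_{‖ξ‖≥K} ‖ξ‖^{2s} ‖û(t)(ξ)‖² dξ` — every sharp spectral tail of every order `s` diverges (the head is capped by
`K^{2s}‖u(0)‖₂²` uniformly in time, the whole moment runs on the clock `spectral_clock`).
[cite: RobinsonSadowski2014, Corollary 10] [cite: Leray1934, §22 p. 227] -/
theorem spectral_tail_eventually_gt (s : ℝ) (hs : s ∈ Ioo (1 / 2 : ℝ) (3 / 2)) {ν T : ℝ} (hν : 0 < ν) (hT : 0 < T)
    {u : ℝ → (EuclideanSpace ℝ (Fin 3)) → (EuclideanSpace ℝ (Fin 3))} {p : ℝ → (EuclideanSpace ℝ (Fin 3)) → ℝ}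
    (hmax : IsMaximalSmoothSolution ν 0 u p T) (hLH : IsLerayHopfOn T ν 0 (u 0) u) (K : ℝ)
    (M : ℝ≥0) :
    ∃ t₁ < T, ∀ t ∈ Ioo t₁ T, ∀ h2 : MemLp (⇑EuclideanSpace.complexify ∘ u t) 2 volume,
      (M : ℝ≥0∞) < ∫⁻ ξ in (Metric.ball (0 : (EuclideanSpace ℝ (Fin 3))) K)ᶜ, ‖ξ‖ₑ ^ (2 * s) *
        ‖((𝓕 (h2.toLp _) : Lp (EuclideanSpace ℂ (Fin 3)) 2 (volume : Measure (EuclideanSpace ℝ (Fin 3)))) : (EuclideanSpace ℝ (Fin 3)) → (EuclideanSpace ℂ (Fin 3))) ξ‖ₑ ^ 2 := by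
  obtain ⟨c, hc, H⟩ := spectral_front_clock s hs
  set E : ℝ≥0∞ := eLpNorm (u 0) 2 volume with hE
  have hEtop : E ≠ ⊤ := (hLH.memLp 0 ⟨le_rfl, hT.le⟩).eLpNorm_ne_top
  set Hd : ℝ≥0∞ := ENNReal.ofReal (K ^ (2 * s)) * E ^ 2 with hHd
  have hHtop : Hd ≠ ⊤ := ENNReal.mul_ne_top ENNReal.ofReal_ne_top (ENNReal.pow_ne_top hEtop)
  -- the clock's left side eventually exceeds `Hd + M`
  have hclock := tendsto_ofReal_clock_top (a := (5 - 2 * s) / 2) (T := T) hc hν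
    (by linarith [hs.1] : 0 < (2 * s - 1) / 2)
  have hev : ∀ᶠ t in 𝓝[<] T, Hd + M < ENNReal.ofReal (c * ν ^ ((5 - 2 * s) / 2) * (T - t) ^ (-((2 * s - 1) / 2))) :=
    hclock.eventually (eventually_gt_nhds (lt_top_iff_ne_top.2 (ENNReal.add_ne_top.2 ⟨hHtop, ENNReal.coe_ne_top⟩)))
  obtain ⟨t₁, ht₁, hsub⟩ := mem_nhdsLT_iff_exists_Ioo_subset.1 (hev.and (Ioo_mem_nhdsLT hT))
  refine ⟨t₁, ht₁, fun t ht h2 => ?_⟩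
  obtain ⟨hgt, ht0⟩ := hsub ht
  have h := H ν T hν hT u p hmax hLH t ht0 h2 K
  have hlt : Hd + M < Hd + ∫⁻ ξ in (Metric.ball (0 : (EuclideanSpace ℝ (Fin 3))) K)ᶜ, ‖ξ‖ₑ ^ (2 * s) *
      ‖((𝓕 (h2.toLp _) : Lp (EuclideanSpace ℂ (Fin 3)) 2 (volume : Measure (EuclideanSpace ℝ (Fin 3)))) : (EuclideanSpace ℝ (Fin 3)) → (EuclideanSpace ℂ (Fin 3))) ξ‖ₑ ^ 2 := hgt.trans_le h
  exact (ENNReal.add_lt_add_iff_left hHtop).1 hlt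

end Summit.NavierStokesRegularity.FluidComputer.SpectralFront

end
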